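import Literature.NumberTheory.Sieve.BoxPrimesCharacterSums
import Literature.NumberTheory.Sieve.NumberFieldVaughanIdentity
import Literature.NumberTheory.LFunctions.MertensPrimeIdeals
import HarnessLib

/-!
# Counting lemmas for the type II coefficients (Hinz 1988, §4, p. 188)

Topic `Literature/NumberTheory/Sieve`, sub-namespace `TypeTwoCoeff`. The coefficient norms in
Hinz's treatment of `S₄`,
`∑'|c₁(α₁)|² = ∑ Λ²(α₁/𝔭₁) ≪ M log M` and
`∑'|c₂(α₂)|² ≪ ∑_{α₂} (∑_{𝔠∣(α₂/𝔭₂), N𝔠≤U} 1)² ≪ log^r x · ∑_{N𝔞≪x/M} τ(𝔞)² ≪ (x/M)(log x)^{r+3}`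
(p. 188), rest on elementary counting over the ideals of `K`, proved here:

* `card_idealsLE_le_linear` — `#{𝔞 ≠ 0 : N𝔞 ≤ x} ≤ C_K x` (tree `idealCount_le_linear`);
  `harmonic_le` — `∑_{N𝔞≤x} 1/N𝔞 ≤ C_K (1 + log x)` (tree `abs_harmonic_sub_log_le`);
* `card_filter_dvd_le` — `#{N𝔠 ≤ y : 𝔩 ∣ 𝔠} ≤ C_K y/N𝔩`;
* `absNorm_inf_eq` — `N(𝔞 ∩ 𝔟) = N(𝔞+𝔟) N(𝔞/(𝔞+𝔟)) N(𝔟/(𝔞+𝔟))` (`(𝔞+𝔟)(𝔞∩𝔟) = 𝔞𝔟`);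
  `sum_inv_absNorm_inf_le` — `∑_{𝔞,𝔟} 1/N(𝔞 ∩ 𝔟) ≤ (∑ 1/N𝔫)³`;
* `tauLE`, `abs_eU_le_tauLE`, `sum_tauLE_sq_le` — `τ_U(𝔠) = #{𝔡 ∣ 𝔠 : N𝔡 ≤ U}`, `|e_U(𝔠)| ≤ τ_U(𝔠)`,
  **`∑_{N𝔠≤y} τ_U(𝔠)² ≤ C_K y (∑_{N𝔡≤U} 1/N𝔡)³`**;
* `card_generators_box₀_le` — the number of generators of a fixed ideal in the cube `A₀(X)` is
  `≤ C_K (1 + log X)^{d-1}` for `X ≥ 1` (tree `MitsuiPNT.card_fiber`, `MitsuiSum.exists_shapeFun_le`);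
* `sum_box₀_le_mul_sum_ideals` — `∑_{α∈A₀(X), Q(α)} f((α)) ≤ C(1+log X)^{d-1} ∑_{N𝔞≤X^d} f(𝔞)` for
  `f ≥ 0`.

## References

* J. Hinz, Acta Arith. 51 (1988), §4, p. 188 (the estimates for `∑'|c₁|²`, `∑'|c₂|²`).
  [cite: Hinz1988, §4 p. 188]
-/

noncomputable section

open Finset NumberField Ideal
  Literature.NumberTheory.LFunctions.NumberField Literature.NumberTheory.Sieve.NumberFieldVaughan
  Literature.NumberTheory.Sieve.CastilloEtAl2015 Literature.NumberTheory.Sieve.MitsuiPNT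
  Literature.NumberTheory.LFunctions.HeckeCone Literature.Algebra.EuclideanLattices.MitsuiSum
  Literature.NumberTheory.LFunctions
open scoped Classical

namespace Literature.NumberTheory.Sieve.TypeTwoCoeff

variable (K : Type*) [Field K] [NumberField K]

local notation "d" => Module.finrank ℚ K

/-! ## Linear ideal count and the harmonic sum -/

/-- `#idealsLE x = I_K(x)`. [folklore] -/
theorem card_idealsLE_eq_idealCount (x : ℝ) : (idealsLE K x).card = idealCount K x :=
  card_idealsLE_eq_natCard (K := K) x

/-- **`#{𝔞 ≠ 0 : N𝔞 ≤ x} ≤ C x` for `x ≥ 1`**, and `= 0` for `x < 1`. [cite: Hinz1988, §2 (2.1)] -/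
theorem card_idealsLE_le_linear : ∃ C : ℝ, 0 < C ∧ ∀ x : ℝ, 0 ≤ x → ((idealsLE K x).card : ℝ) ≤ C * x := by
  obtain ⟨C, hC⟩ := idealCount_le_linear K
  refine ⟨max C 1, by positivity, fun x hx => ?_⟩
  rcases lt_or_ge x 1 with h1 | h1
  · have : idealsLE K x = ∅ := by
      rw [Finset.eq_empty_iff_forall_notMem]
      intro I hI
      have := one_le_absNorm_of_mem_idealsLE hI
      have h2 := (mem_idealsLE.1 hI).2
      have : (1 : ℝ) ≤ Ideal.absNorm I := by exact_mod_cast this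
      linarith
    rw [this, Finset.card_empty, Nat.cast_zero]; positivity
  · rw [card_idealsLE_eq_idealCount]
    calc (idealCount K x : ℝ) ≤ C * x := hC x h1
      _ ≤ max C 1 * x := mul_le_mul_of_nonneg_right (le_max_left _ _) hx

/-- **The harmonic sum over ideals**: `∑_{N𝔞≤x} 1/N𝔞 ≤ C (1 + log x)` for `x ≥ 1` (and `= 0` for
`x < 1`). [cite: Hinz1988, §2 (2.1)] -/
theorem harmonic_le : ∃ C : ℝ, 0 < C ∧ ∀ x : ℝ, 1 ≤ x →
    ∑ 𝔞 ∈ idealsLE K x, ((Ideal.absNorm 𝔞 : ℕ) : ℝ)⁻¹ ≤ C * (1 + Real.log x) := by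
  obtain ⟨C, hC⟩ := abs_harmonic_sub_log_le K
  have hρ := (NumberField.dedekindZeta_residue_pos K).le
  refine ⟨max (|C|) (NumberField.dedekindZeta_residue K) + 1, by positivity, fun x hx => ?_⟩
  have h := (abs_le.1 (hC x hx)).2
  have hlog : 0 ≤ Real.log x := Real.log_nonneg hx
  have h1 : |C| ≤ max (|C|) (NumberField.dedekindZeta_residue K) + 1 := by linarith [le_max_left (|C|) (NumberField.dedekindZeta_residue K)]
  have h2 : NumberField.dedekindZeta_residue K ≤ max (|C|) (NumberField.dedekindZeta_residue K) + 1 := by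
    linarith [le_max_right (|C|) (NumberField.dedekindZeta_residue K)]
  calc ∑ 𝔞 ∈ idealsLE K x, ((Ideal.absNorm 𝔞 : ℕ) : ℝ)⁻¹ ≤ C + NumberField.dedekindZeta_residue K * Real.log x := by linarith
    _ ≤ |C| + NumberField.dedekindZeta_residue K * Real.log x := by linarith [le_abs_self C]
    _ ≤ (max (|C|) (NumberField.dedekindZeta_residue K) + 1) * 1 +
          (max (|C|) (NumberField.dedekindZeta_residue K) + 1) * Real.log x := by
        gcongr; linarith
    _ = _ := by ring

variable {K}

/-- Harmonic sums are nonnegative. [folklore] -/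
theorem harmonic_nonneg (x : ℝ) : 0 ≤ ∑ 𝔞 ∈ idealsLE K x, ((Ideal.absNorm 𝔞 : ℕ) : ℝ)⁻¹ :=
  Finset.sum_nonneg fun _ _ => by positivity

/-- `N𝔞 > 0` as a real number for `𝔞 ∈ idealsLE`. [folklore] -/
theorem absNorm_pos_of_ne_bot {𝔞 : Ideal (𝓞 K)} (h : 𝔞 ≠ ⊥) : (0 : ℝ) < Ideal.absNorm 𝔞 := by
  have : Ideal.absNorm 𝔞 ≠ 0 := by rwa [Ne, Ideal.absNorm_eq_zero_iff]
  positivity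

/-! ## Multiples of a fixed ideal -/

/-- **`#{𝔠 ≠ 0 : N𝔠 ≤ y, 𝔩 ∣ 𝔠} ≤ C y/N𝔩`** (`𝔠 ↦ 𝔠/𝔩` is injective into `{N ≤ y/N𝔩}`).
[cite: Hinz1988, §2 (2.1)] -/
theorem card_filter_dvd_le {C : ℝ} (hC : ∀ x : ℝ, 0 ≤ x → ((idealsLE K x).card : ℝ) ≤ C * x)
    {𝔩 : Ideal (𝓞 K)} (h𝔩 : 𝔩 ≠ ⊥) {y : ℝ} (hy : 0 ≤ y) :
    (((idealsLE K y).filter (fun 𝔠 => 𝔩 ∣ 𝔠)).card : ℝ) ≤ C * (y / Ideal.absNorm 𝔩) := by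
  have hN := absNorm_pos_of_ne_bot h𝔩
  have hinj : Set.InjOn (fun 𝔠 => cofactor 𝔠 𝔩) ((idealsLE K y).filter (fun 𝔠 => 𝔩 ∣ 𝔠)) := by
    intro 𝔠 h𝔠 𝔠' h𝔠' h
    have e1 := mul_cofactor (Finset.mem_filter.1 h𝔠).2
    have e2 := mul_cofactor (Finset.mem_filter.1 h𝔠').2
    simp only at h
    rw [← e1, ← e2, h]
  have hmaps : ∀ 𝔠 ∈ (idealsLE K y).filter (fun 𝔠 => 𝔩 ∣ 𝔠), cofactor 𝔠 𝔩 ∈ idealsLE K (y / Ideal.absNorm 𝔩) := by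
    intro 𝔠 h𝔠
    rw [Finset.mem_filter, mem_idealsLE] at h𝔠
    obtain ⟨⟨h𝔠0, h𝔠y⟩, hdvd⟩ := h𝔠
    rw [mem_idealsLE]
    refine ⟨cofactor_ne_bot h𝔠0 hdvd, ?_⟩
    rw [le_div_iff₀ hN]
    have := mul_cofactor hdvd
    have hmul : (Ideal.absNorm 𝔠 : ℝ) = Ideal.absNorm 𝔩 * Ideal.absNorm (cofactor 𝔠 𝔩) := by
      conv_lhs => rw [← this]
      rw [map_mul, Nat.cast_mul]
    nlinarith
  calc (((idealsLE K y).filter (fun 𝔠 => 𝔩 ∣ 𝔠)).card : ℝ)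
      = ((((idealsLE K y).filter (fun 𝔠 => 𝔩 ∣ 𝔠)).image fun 𝔠 => cofactor 𝔠 𝔩).card : ℝ) := by
        rw [Finset.card_image_of_injOn hinj]
    _ ≤ ((idealsLE K (y / Ideal.absNorm 𝔩)).card : ℝ) := by
        exact_mod_cast Finset.card_le_card fun 𝔤 h𝔤 => by
          obtain ⟨𝔠, h𝔠, rfl⟩ := Finset.mem_image.1 h𝔤; exact hmaps 𝔠 h𝔠
    _ ≤ C * (y / Ideal.absNorm 𝔩) := hC _ (div_nonneg hy hN.le)

/-! ## `N(𝔞 ∩ 𝔟)` and the sum `∑ 1/N(𝔞 ∩ 𝔟)` -/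

/-- **`𝔞 ∩ 𝔟 = (𝔞+𝔟) · 𝔞/(𝔞+𝔟) · 𝔟/(𝔞+𝔟)`** for nonzero ideals of a Dedekind domain
(`(𝔞+𝔟)(𝔞∩𝔟) = 𝔞𝔟`, Mathlib `Ideal.sup_mul_inf`). [folklore] -/
theorem inf_eq_mul (𝔞 𝔟 : Ideal (𝓞 K)) (h𝔞 : 𝔞 ≠ ⊥) :
    𝔞 ⊓ 𝔟 = (𝔞 ⊔ 𝔟) * cofactor 𝔞 (𝔞 ⊔ 𝔟) * cofactor 𝔟 (𝔞 ⊔ 𝔟) := by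
  set g := 𝔞 ⊔ 𝔟 with hgdef
  have hg : g ≠ ⊥ := fun h => h𝔞 (le_bot_iff.1 (h ▸ le_sup_left))
  have hda : g ∣ 𝔞 := Ideal.dvd_iff_le.2 le_sup_left
  have hdb : g ∣ 𝔟 := Ideal.dvd_iff_le.2 le_sup_right
  have h2 : g * (𝔞 ⊓ 𝔟) = g * (g * cofactor 𝔞 g * cofactor 𝔟 g) :=
    calc g * (𝔞 ⊓ 𝔟) = 𝔞 * 𝔟 := Ideal.sup_mul_inf 𝔞 𝔟
      _ = (g * cofactor 𝔞 g) * (g * cofactor 𝔟 g) := by rw [mul_cofactor hda, mul_cofactor hdb]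
      _ = g * (g * cofactor 𝔞 g * cofactor 𝔟 g) := by ring
  exact mul_left_cancel₀ hg h2

/-- `N(𝔞 ∩ 𝔟) = N(𝔞+𝔟) N(𝔞/(𝔞+𝔟)) N(𝔟/(𝔞+𝔟))`. [folklore] -/
theorem absNorm_inf_eq (𝔞 𝔟 : Ideal (𝓞 K)) (h𝔞 : 𝔞 ≠ ⊥) :
    (Ideal.absNorm (𝔞 ⊓ 𝔟) : ℝ) =
      Ideal.absNorm (𝔞 ⊔ 𝔟) * Ideal.absNorm (cofactor 𝔞 (𝔞 ⊔ 𝔟)) * Ideal.absNorm (cofactor 𝔟 (𝔞 ⊔ 𝔟)) := by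
  rw [inf_eq_mul 𝔞 𝔟 h𝔞, map_mul, map_mul, Nat.cast_mul, Nat.cast_mul]

/-- **`∑_{𝔞,𝔟 ∈ idealsLE x} 1/N(𝔞 ∩ 𝔟) ≤ (∑_{𝔫 ∈ idealsLE x} 1/N𝔫)³`**: the map
`(𝔞, 𝔟) ↦ (𝔞+𝔟, 𝔞/(𝔞+𝔟), 𝔟/(𝔞+𝔟))` is injective. [cite: Hinz1988, §4 p. 188] -/
theorem sum_inv_absNorm_inf_le (x : ℝ) :
    ∑ 𝔞 ∈ idealsLE K x, ∑ 𝔟 ∈ idealsLE K x, ((Ideal.absNorm (𝔞 ⊓ 𝔟) : ℕ) : ℝ)⁻¹ ≤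
      (∑ 𝔫 ∈ idealsLE K x, ((Ideal.absNorm 𝔫 : ℕ) : ℝ)⁻¹) ^ 3 := by
  set L := idealsLE K x with hL
  set e : Ideal (𝓞 K) × Ideal (𝓞 K) → Ideal (𝓞 K) × Ideal (𝓞 K) × Ideal (𝓞 K) :=
    fun p => (p.1 ⊔ p.2, cofactor p.1 (p.1 ⊔ p.2), cofactor p.2 (p.1 ⊔ p.2)) with he
  set a : Ideal (𝓞 K) → ℝ := fun 𝔫 => ((Ideal.absNorm 𝔫 : ℕ) : ℝ)⁻¹ with ha
  set F : Ideal (𝓞 K) × Ideal (𝓞 K) × Ideal (𝓞 K) → ℝ := fun t => a t.1 * (a t.2.1 * a t.2.2) with hF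
  have hF0 : ∀ t, 0 ≤ F t := fun t => by simp only [hF, ha]; positivity
  have hmem : ∀ p ∈ L ×ˢ L, p.1 ≠ ⊥ ∧ (Ideal.absNorm p.1 : ℝ) ≤ x ∧ p.2 ≠ ⊥ ∧ (Ideal.absNorm p.2 : ℝ) ≤ x := by
    intro p hp
    rw [Finset.mem_product, hL, mem_idealsLE, mem_idealsLE] at hp
    exact ⟨hp.1.1, hp.1.2, hp.2.1, hp.2.2⟩
  -- termwise identity
  have hterm : ∀ p ∈ L ×ˢ L, ((Ideal.absNorm (p.1 ⊓ p.2) : ℕ) : ℝ)⁻¹ = F (e p) := by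
    intro p hp
    simp only [hF, he, ha]
    rw [absNorm_inf_eq p.1 p.2 (hmem p hp).1, mul_inv, mul_inv, mul_assoc]
  -- injectivity
  have hinj : Set.InjOn e ((L ×ˢ L : Finset (Ideal (𝓞 K) × Ideal (𝓞 K))) : Set _) := by
    intro p hp p' hp' h
    rw [Finset.mem_coe] at hp hp'
    simp only [he, Prod.mk.injEq] at h
    obtain ⟨h1, h2, h3⟩ := h
    have ha : p.1 = p'.1 := by
      rw [← mul_cofactor (Ideal.dvd_iff_le.2 (le_sup_left : p.1 ≤ p.1 ⊔ p.2)),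
        ← mul_cofactor (Ideal.dvd_iff_le.2 (le_sup_left : p'.1 ≤ p'.1 ⊔ p'.2)), h2, h1]
    have hb : p.2 = p'.2 := by
      rw [← mul_cofactor (Ideal.dvd_iff_le.2 (le_sup_right : p.2 ≤ p.1 ⊔ p.2)),
        ← mul_cofactor (Ideal.dvd_iff_le.2 (le_sup_right : p'.2 ≤ p'.1 ⊔ p'.2)), h3, h1]
    exact Prod.ext ha hb
  -- image inside `L × L × L`
  have hdvd_mem : ∀ {𝔞 𝔟 : Ideal (𝓞 K)}, 𝔞 ∈ L → 𝔟 ∣ 𝔞 → 𝔟 ∈ L := by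
    intro 𝔞 𝔟 h𝔞 hdvd
    rw [hL, mem_idealsLE] at h𝔞 ⊢
    refine ⟨fun h => h𝔞.1 ?_, le_trans ?_ h𝔞.2⟩
    · obtain ⟨c, rfl⟩ := hdvd; rw [h]; simp
    · have hpos : 0 < Ideal.absNorm 𝔞 := Nat.pos_of_ne_zero (by rw [Ne, Ideal.absNorm_eq_zero_iff]; exact h𝔞.1)
      exact_mod_cast Nat.le_of_dvd hpos (Ideal.absNorm_dvd_absNorm_of_le (Ideal.le_of_dvd hdvd))
  have himage : (L ×ˢ L).image e ⊆ L ×ˢ (L ×ˢ L) := by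
    intro t ht
    obtain ⟨p, hp, rfl⟩ := Finset.mem_image.1 ht
    have hp' := Finset.mem_product.1 hp
    have hda : p.1 ⊔ p.2 ∣ p.1 := Ideal.dvd_iff_le.2 le_sup_left
    have hdb : p.1 ⊔ p.2 ∣ p.2 := Ideal.dvd_iff_le.2 le_sup_right
    simp only [he, Finset.mem_product]
    exact ⟨hdvd_mem hp'.1 hda, hdvd_mem hp'.1 (cofactor_dvd hda), hdvd_mem hp'.2 (cofactor_dvd hdb)⟩
  have hprod : ∑ 𝔞 ∈ L, ∑ 𝔟 ∈ L, ((Ideal.absNorm (𝔞 ⊓ 𝔟) : ℕ) : ℝ)⁻¹ =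
      ∑ p ∈ L ×ˢ L, ((Ideal.absNorm (p.1 ⊓ p.2) : ℕ) : ℝ)⁻¹ :=
    (Finset.sum_product L L (fun p => ((Ideal.absNorm (p.1 ⊓ p.2) : ℕ) : ℝ)⁻¹)).symm
  have hcube : ∑ t ∈ L ×ˢ (L ×ˢ L), F t = (∑ 𝔫 ∈ L, a 𝔫) ^ 3 := by
    rw [Finset.sum_product L (L ×ˢ L) F, pow_three, Finset.sum_mul]
    refine Finset.sum_congr rfl fun 𝔤 _ => ?_
    rw [Finset.sum_product L L (fun q => F (𝔤, q)), Finset.sum_mul_sum, Finset.mul_sum]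
    refine Finset.sum_congr rfl fun 𝔞 _ => ?_
    rw [Finset.mul_sum]
  rw [hprod]
  calc ∑ p ∈ L ×ˢ L, ((Ideal.absNorm (p.1 ⊓ p.2) : ℕ) : ℝ)⁻¹
      = ∑ p ∈ L ×ˢ L, F (e p) := Finset.sum_congr rfl hterm
    _ = ∑ t ∈ (L ×ˢ L).image e, F t := (Finset.sum_image hinj).symm
    _ ≤ ∑ t ∈ L ×ˢ (L ×ˢ L), F t := Finset.sum_le_sum_of_subset_of_nonneg himage fun t _ _ => hF0 t
    _ = (∑ 𝔫 ∈ L, a 𝔫) ^ 3 := hcube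

/-! ## `τ_U` and `∑ τ_U²` -/

variable (K) in
/-- `τ_U(𝔠) = #{𝔡 ∣ 𝔠 : 0 < N𝔡 ≤ U}`. [cite: Hinz1988, §4 (4.17)] -/
def tauLE (U : ℝ) (𝔠 : Ideal (𝓞 K)) : ℕ := ((idealsLE K U).filter (· ∣ 𝔠)).card

/-- **`|e_U(𝔠)| ≤ τ_U(𝔠)`** (`|μ| ≤ 1`). [cite: Hinz1988, §4 (4.17)] -/
theorem abs_eU_le_tauLE (U : ℝ) {𝔠 : Ideal (𝓞 K)} (h𝔠 : 𝔠 ≠ ⊥) : |eU K U 𝔠| ≤ tauLE K U 𝔠 := by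
  unfold eU tauLE
  have hset : ∀ 𝔡 ∈ idealDivisors K 𝔠, muLE K U 𝔡 ≠ 0 → 𝔡 ∈ (idealsLE K U).filter (· ∣ 𝔠) := by
    intro 𝔡 h𝔡 hne
    rw [Finset.mem_filter, mem_idealsLE, ← mem_idealDivisors h𝔠]
    unfold muLE at hne
    refine ⟨⟨NumberField.ne_bot_of_mem_idealDivisors h𝔠 h𝔡, ?_⟩, h𝔡⟩
    by_contra h; exact hne (if_neg h)
  calc |∑ 𝔡 ∈ idealDivisors K 𝔠, muLE K U 𝔡|
      = |∑ 𝔡 ∈ (idealDivisors K 𝔠).filter (fun 𝔡 => muLE K U 𝔡 ≠ 0), muLE K U 𝔡| := by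
        rw [Finset.sum_filter_ne_zero]
    _ ≤ ∑ 𝔡 ∈ (idealDivisors K 𝔠).filter (fun 𝔡 => muLE K U 𝔡 ≠ 0), |muLE K U 𝔡| := Finset.abs_sum_le_sum_abs _ _
    _ ≤ ∑ 𝔡 ∈ (idealDivisors K 𝔠).filter (fun 𝔡 => muLE K U 𝔡 ≠ 0), (1 : ℝ) := by
        refine Finset.sum_le_sum fun 𝔡 _ => ?_
        unfold muLE; split_ifs
        · exact_mod_cast abs_idealMoebius_le_one 𝔡
        · simp
    _ = (((idealDivisors K 𝔠).filter (fun 𝔡 => muLE K U 𝔡 ≠ 0)).card : ℝ) := by simp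
    _ ≤ _ := by
        exact_mod_cast Finset.card_le_card fun 𝔡 h𝔡 => hset 𝔡 (Finset.mem_filter.1 h𝔡).1 (Finset.mem_filter.1 h𝔡).2

/-- **`∑_{N𝔠≤y} τ_U(𝔠)² ≤ C y (∑_{N𝔡≤U} 1/N𝔡)³`** (expand the square, count multiples of
`𝔡₁ ∩ 𝔡₂`, `sum_inv_absNorm_inf_le`). [cite: Hinz1988, §4 p. 188] -/
theorem sum_tauLE_sq_le {C : ℝ} (hC0 : 0 ≤ C) (hC : ∀ x : ℝ, 0 ≤ x → ((idealsLE K x).card : ℝ) ≤ C * x)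
    (U : ℝ) {y : ℝ} (hy : 0 ≤ y) :
    ∑ 𝔠 ∈ idealsLE K y, (tauLE K U 𝔠 : ℝ) ^ 2 ≤
      C * y * (∑ 𝔡 ∈ idealsLE K U, ((Ideal.absNorm 𝔡 : ℕ) : ℝ)⁻¹) ^ 3 := by
  set LU := idealsLE K U with hLU
  have hsq : ∀ 𝔠, (tauLE K U 𝔠 : ℝ) ^ 2 = ∑ 𝔡₁ ∈ LU, ∑ 𝔡₂ ∈ LU,
      (if 𝔡₁ ∣ 𝔠 then (1 : ℝ) else 0) * (if 𝔡₂ ∣ 𝔠 then (1 : ℝ) else 0) := by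
    intro 𝔠
    have h1 : (tauLE K U 𝔠 : ℝ) = ∑ 𝔡 ∈ LU, if 𝔡 ∣ 𝔠 then (1 : ℝ) else 0 := by
      rw [tauLE, Finset.sum_boole, hLU]
    rw [h1, sq, Finset.sum_mul_sum]
  simp_rw [hsq]
  rw [Finset.sum_comm]
  simp_rw [Finset.sum_comm (s := idealsLE K y) (t := LU)]
  have hLUmem : ∀ 𝔡 ∈ LU, 𝔡 ≠ ⊥ := fun 𝔡 h => (mem_idealsLE.1 h).1
  calc ∑ 𝔡₁ ∈ LU, ∑ 𝔡₂ ∈ LU, ∑ 𝔠 ∈ idealsLE K y,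
        (if 𝔡₁ ∣ 𝔠 then (1 : ℝ) else 0) * (if 𝔡₂ ∣ 𝔠 then (1 : ℝ) else 0)
      = ∑ 𝔡₁ ∈ LU, ∑ 𝔡₂ ∈ LU, (((idealsLE K y).filter (fun 𝔠 => 𝔡₁ ⊓ 𝔡₂ ∣ 𝔠)).card : ℝ) := by
        refine Finset.sum_congr rfl fun 𝔡₁ _ => Finset.sum_congr rfl fun 𝔡₂ _ => ?_
        rw [← Finset.sum_boole]
        refine Finset.sum_congr rfl fun 𝔠 _ => ?_
        have : 𝔡₁ ⊓ 𝔡₂ ∣ 𝔠 ↔ 𝔡₁ ∣ 𝔠 ∧ 𝔡₂ ∣ 𝔠 := by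
          rw [Ideal.dvd_iff_le, Ideal.dvd_iff_le, Ideal.dvd_iff_le, le_inf_iff]
        by_cases h1 : 𝔡₁ ∣ 𝔠 <;> by_cases h2 : 𝔡₂ ∣ 𝔠 <;> simp [h1, h2, this]
    _ ≤ ∑ 𝔡₁ ∈ LU, ∑ 𝔡₂ ∈ LU, C * (y / Ideal.absNorm (𝔡₁ ⊓ 𝔡₂)) := by
        refine Finset.sum_le_sum fun 𝔡₁ h₁ => Finset.sum_le_sum fun 𝔡₂ h₂ => ?_
        have hne : 𝔡₁ ⊓ 𝔡₂ ≠ ⊥ := by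
          rw [Ne, Submodule.eq_bot_iff]
          push Not
          have h1 := hLUmem 𝔡₁ h₁; have h2 := hLUmem 𝔡₂ h₂
          have hprod : 𝔡₁ * 𝔡₂ ≠ ⊥ := mul_ne_zero h1 h2
          obtain ⟨z, hz, hz0⟩ := Submodule.exists_mem_ne_zero_of_ne_bot hprod
          exact ⟨z, Ideal.mul_le_inf hz, hz0⟩
        exact card_filter_dvd_le hC hne hy
    _ = C * y * ∑ 𝔡₁ ∈ LU, ∑ 𝔡₂ ∈ LU, ((Ideal.absNorm (𝔡₁ ⊓ 𝔡₂) : ℕ) : ℝ)⁻¹ := by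
        rw [Finset.mul_sum]
        refine Finset.sum_congr rfl fun 𝔡₁ _ => ?_
        rw [Finset.mul_sum]
        refine Finset.sum_congr rfl fun 𝔡₂ _ => ?_
        rw [div_eq_mul_inv]; ring
    _ ≤ C * y * (∑ 𝔡 ∈ LU, ((Ideal.absNorm 𝔡 : ℕ) : ℝ)⁻¹) ^ 3 :=
        mul_le_mul_of_nonneg_left (sum_inv_absNorm_inf_le U) (by positivity)

/-! ## Generators of a fixed ideal in the cube `A₀(X)` -/

section TotallyReal

variable [IsTotallyReal K]

/-- **The number of generators of a fixed ideal in `A₀(X)` is `≤ C (1 + log X)^{d-1}`** for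
`X ≥ 1` (totally positive units with bounded logarithms; tree `card_fiber`,
`exists_shapeFun_le`). [cite: Hinz1988, §4 p. 188] -/
theorem card_generators_box₀_le : ∃ C : ℝ, 0 ≤ C ∧ ∀ X : ℝ, 1 ≤ X → ∀ I : Ideal (𝓞 K),
    (Nat.card {α : 𝓞 K // α ∈ box₀ K X ∧ Ideal.span {α} = I} : ℝ) ≤
      C * (1 + Real.log X) ^ Module.finrank ℝ (NumberField.Units.dirichletUnitTheorem.logSpace K) := by
  obtain ⟨R₀, hR₀⟩ := (isBounded_logBox (K := K)).subset_closedBall 0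
  set R : ℝ := max R₀ 0 with hRdef
  have hR : logBox K ⊆ Metric.closedBall 0 R := hR₀.trans (Metric.closedBall_subset_closedBall (le_max_left _ _))
  obtain ⟨C, hC0, hC⟩ := exists_shapeFun_le (L := posUnitLattice K) MeasureTheory.volume hR (le_max_right _ _)
  have hd : (0 : ℝ) < d := by exact_mod_cast Module.finrank_pos (R := ℚ) (M := K)
  refine ⟨C, hC0, fun X hX I => ?_⟩
  have hX0 : 0 < X := by linarith
  have hfin : ({α : 𝓞 K | α ∈ box₀ K X ∧ Ideal.span {α} = I} : Set (𝓞 K)).Finite :=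
    (finite_box₀ _).subset fun α h => h.1
  rcases Set.eq_empty_or_nonempty {α : 𝓞 K | α ∈ box₀ K X ∧ Ideal.span {α} = I} with hempty | ⟨α₀, hα₀⟩
  · have : Nat.card {α : 𝓞 K // α ∈ box₀ K X ∧ Ideal.span {α} = I} = 0 := by
      have hc : Nat.card {α : 𝓞 K // α ∈ box₀ K X ∧ Ideal.span {α} = I} = hfin.toFinset.card :=
        Nat.card_eq_card_finite_toFinset hfin
      rw [hc, Finset.card_eq_zero, ← Finset.coe_eq_empty, Set.Finite.coe_toFinset]
      exact hempty
    rw [this, Nat.cast_zero]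
    have hlog : 0 ≤ Real.log X := Real.log_nonneg hX
    exact mul_nonneg hC0 (pow_nonneg (by linarith) _)
  · obtain ⟨hP, h1, h2⟩ := span_mem_idealFamily (K := K) hα₀.1
    rw [hα₀.2] at hP h1 h2
    rw [card_fiber hX0 hP h2]
    have hm1 : (1 : ℝ) ≤ Ideal.absNorm I := by exact_mod_cast h1
    have hs0 : 0 ≤ Real.log (X ^ d / Ideal.absNorm I) / d := by
      refine div_nonneg (Real.log_nonneg ?_) hd.le
      rwa [le_div_iff₀ (by linarith), one_mul]
    have hsle : Real.log (X ^ d / Ideal.absNorm I) / d ≤ Real.log X := by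
      rw [div_le_iff₀ hd, Real.log_div (pow_ne_zero _ hX0.ne') (by linarith), Real.log_pow]
      have : 0 ≤ Real.log (Ideal.absNorm I : ℝ) := Real.log_nonneg hm1
      nlinarith
    refine (hC _ hs0 (logPt K I)).trans ?_
    have h1log : 0 ≤ 1 + Real.log (X ^ d / Ideal.absNorm I) / d := by linarith
    exact mul_le_mul_of_nonneg_left (pow_le_pow_left₀ h1log (by linarith only [hsle]) _) hC0

omit [IsTotallyReal K] in
/-- The generators-of-a-fixed-ideal count as a `Finset` cardinality. [folklore] -/
theorem card_filter_span_eq_le {C : ℝ}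
    (hC : ∀ X : ℝ, 1 ≤ X → ∀ I : Ideal (𝓞 K),
      (Nat.card {α : 𝓞 K // α ∈ box₀ K X ∧ Ideal.span {α} = I} : ℝ) ≤
        C * (1 + Real.log X) ^ Module.finrank ℝ (NumberField.Units.dirichletUnitTheorem.logSpace K))
    {X : ℝ} (hX : 1 ≤ X) (S : Finset (𝓞 K)) (hS : ∀ α ∈ S, α ∈ box₀ K X) (I : Ideal (𝓞 K)) :
    (((S.filter fun α => Ideal.span {α} = I).card : ℕ) : ℝ) ≤
      C * (1 + Real.log X) ^ Module.finrank ℝ (NumberField.Units.dirichletUnitTheorem.logSpace K) := by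
  have hfin : ({α : 𝓞 K | α ∈ box₀ K X ∧ Ideal.span {α} = I} : Set (𝓞 K)).Finite :=
    (finite_box₀ _).subset fun α h => h.1
  have hle : (((S.filter fun α => Ideal.span {α} = I).card : ℕ) : ℝ) ≤
      Nat.card {α : 𝓞 K // α ∈ box₀ K X ∧ Ideal.span {α} = I} := by
    have hc : Nat.card {α : 𝓞 K // α ∈ box₀ K X ∧ Ideal.span {α} = I} = hfin.toFinset.card :=
      Nat.card_eq_card_finite_toFinset hfin
    rw [hc]
    exact_mod_cast Finset.card_le_card fun α hα => by
      rw [Set.Finite.mem_toFinset]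
      rw [Finset.mem_filter] at hα
      exact ⟨hS α hα.1, hα.2⟩
  exact hle.trans (hC X hX I)

/-- **Sums over the cube through the ideals**: for `f ≥ 0` on ideals and `S ⊆ A₀(X)` (`X ≥ 1`),
`∑_{α ∈ S} f((α)) ≤ C (1 + log X)^{d-1} ∑_{𝔞 ∈ idealsLE X^d} f(𝔞)`. [cite: Hinz1988, §4 p. 188] -/
theorem sum_box₀_le_mul_sum_ideals {C : ℝ} (hC0 : 0 ≤ C)
    (hC : ∀ X : ℝ, 1 ≤ X → ∀ I : Ideal (𝓞 K),
      (Nat.card {α : 𝓞 K // α ∈ box₀ K X ∧ Ideal.span {α} = I} : ℝ) ≤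
        C * (1 + Real.log X) ^ Module.finrank ℝ (NumberField.Units.dirichletUnitTheorem.logSpace K))
    {X : ℝ} (hX : 1 ≤ X) (S : Finset (𝓞 K)) (hS : ∀ α ∈ S, α ∈ box₀ K X)
    (f : Ideal (𝓞 K) → ℝ) (hf : ∀ 𝔞, 0 ≤ f 𝔞) :
    ∑ α ∈ S, f (Ideal.span {α}) ≤
      C * (1 + Real.log X) ^ Module.finrank ℝ (NumberField.Units.dirichletUnitTheorem.logSpace K) *
        ∑ 𝔞 ∈ idealsLE K (X ^ d), f 𝔞 := by
  set Lg := C * (1 + Real.log X) ^ Module.finrank ℝ (NumberField.Units.dirichletUnitTheorem.logSpace K) with hLg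
  have hLg0 : 0 ≤ Lg := by
    have : 0 ≤ Real.log X := Real.log_nonneg hX
    positivity
  have hmaps : ∀ α ∈ S, Ideal.span {α} ∈ idealsLE K (X ^ d) := by
    intro α hα
    obtain ⟨_, h1, h2⟩ := span_mem_idealFamily (K := K) (hS α hα)
    rw [mem_idealsLE]
    exact ⟨by rw [Ne, Ideal.span_singleton_eq_bot]; exact ne_zero_of_mem_box₀ (hS α hα), h2⟩
  rw [← Finset.sum_fiberwise_of_maps_to hmaps, Finset.mul_sum]
  refine Finset.sum_le_sum fun 𝔞 _ => ?_
  rw [Finset.sum_congr rfl fun α hα => by rw [(Finset.mem_filter.1 hα).2], Finset.sum_const, nsmul_eq_mul]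
  exact mul_le_mul_of_nonneg_right (card_filter_span_eq_le hC hX S hS 𝔞) (hf 𝔞)

end TotallyReal

end Literature.NumberTheory.Sieve.TypeTwoCoeff
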